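import Mathlib
import Summits.Ventures.HodgeRepro.LitRankKubotaT2
import Summits.Ventures.HodgeRepro.LitRankTheta
import Summits.Ventures.HodgeRepro.KubotaLit2

/-!
# LitRankKubotaT2Holds — Kubota 1965, Theorem 2, holds

Blind cell `pub-hodge-repro`, seat lit-2 (gen 6).  Assembles

* `Kubota1965_theorem2_of_lemma3` (`LitRankKubotaT2.lean`, same seat: Kubota's printed deduction of
  Theorem 2 from the character formula and Lemma 3, p0009:L55–L63),
* `Kubota_rank_abelian_charFormula_holds` (seat typer-2, `KubotaLit2.lean`), and
* `Kubota1965_lemma3_Leopoldt_holds` (`LitRankTheta.lean`, same seat: Leopoldt's lemma via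
  `L(χ, 0) = −(1/p)·Σ χ(a)·a ≠ 0`)

into the unconditional discharge of the named fact `Kubota1965_theorem2_fermatType_nondegenerate`
of `LitRank.lean`: the Jacobian of `y² = 1 − x^p`, `p` an odd prime, is nondegenerate (Kubota 1965,
Theorem 2, p0009:L62–L64).  With this file every one of the 11 printed facts of `LitRank.lean`
is a kernel theorem.
-/

namespace HodgeRepro.Lit2

/-- **Kubota 1965, Theorem 2, holds**: for every odd prime `p`, the CM-type of the Jacobian of the
Fermat-type curve `y² = 1 − x^p` (`F = ℚ(ζ_p)`, `G = (ℤ/p)ˣ`, `ρ = −1`, `S = {σ_i : i ≤ (p−1)/2}`)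
is nondegenerate. -/
theorem Kubota1965_theorem2_fermatType_nondegenerate_holds :
    Kubota1965_theorem2_fermatType_nondegenerate :=
  Kubota1965_theorem2_of_lemma3 Kubota_rank_abelian_charFormula_holds
    Kubota1965_lemma3_Leopoldt_holds

end HodgeRepro.Lit2
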